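import Summits.RiemannHypothesis.RiemannHypothesis.Theorems.GroundBartaEvenWinsBeyondArchDeflationM80FFinal
import Summits.RiemannHypothesis.RiemannHypothesis.Theorems.GroundBartaEvenWinsBeyondArchDeflationCrossGram
import HarnessLib

/-!
# RiemannHypothesis / GroundBarta — rung 4: the cell `[…, 4023/5000]` — L-side modulo R-layer data, CROSS-GRAM form

Helper file (`--supports stmt-RiemannHypothesis-18085`), RH-free, no definitions, no named facts.  Prover A (gen 4 of unit
`sr-gb-rung-a`).

`dt_m80F_oddLower_of_gramT`: as `dt_m80F_oddLower_of_sigmaT` (file …M80FFinalT: β-certificate M77Y, Markov-free A-layer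
bounds `m80FTAlo/m80FTAhi`, exact Gram `m80FG`, sharp `M_c` bracket) but the residual Gram matrix enters through the CROSS-GRAM
criterion (file …CrossGram) instead of the sigma criterion: prover B supplies the norm bounds `∫‖r_i‖² ≤ s_i` AND two-sided
boxes `Rlo_ij ≤ ∫ Re(r_i r̄_j) ≤ Rhi_ij` for `i ≠ j` (certified cross integrals for the pairs that matter, the boxes of
`dt_abs_cross_le` for the others), and the kernel checks the scaled `LᵀDL` certificate of
`(β−λ)(A − λG) − R'`, `R'_ii = s_i`.  Why: at `b = 0.8046` the certified norms give `Σ s_i/T_i = 1.105` (sigma criterion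
infeasible) while the residuals of the degree-55 vectors have correlations `0.69 / 0.15 / 0.76` (modes 0,1,2) and the Gram
test passes at `0.71` (all pairs) — `0.83` with only `R₀₁, R₀₂, R₁₂` certified.
-/

set_option linter.dupNamespace false

noncomputable section

open MeasureTheory Set
open scoped BigOperators ComplexConjugate

namespace Summit.RiemannHypothesis.RiemannHypothesis.Theorems.EvenWinsBeyondArch

open Literature.NumberTheory.LFunctions Literature.Analysis.ValidatedNumerics.ExpPoly
open Literature.Analysis.ValidatedNumerics.PolyMP
open Summit.RiemannHypothesis.RiemannHypothesis.Theorems.OddSector (weilDirichletEnergy₂ weilPoleForm₂)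

/-- **`λ ≤ ε_od(4023/5000)` modulo the R-layer data, cross-Gram form.**  `W` is prover B's coefficient matrix, `s_i` the
certified residual norm bounds, `[Rlo_ij, Rhi_ij]` (`i ≠ j`) boxes for the cross integrals (the diagonal boxes must be
`[s_i, s_i]`); `sc, P, E, D, L, δ` the scaled kernel certificate (`cert/abgen/gramcert.py`). [folklore] -/
theorem dt_m80F_oddLower_of_gramT (W : Fin 6 → Fin 6 → ℝ) (s : Fin 6 → ℚ)
    (hs : ∀ i, ∫ x, ‖(m80FF i - ∑ l, W i l • m80Fv l) x‖ ^ 2 ≤ (s i : ℝ))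
    (Rlo Rhi : Fin 6 → Fin 6 → ℚ) (hRdiag : ∀ i, Rlo i i = s i ∧ Rhi i i = s i)
    (hR : ∀ i j, i ≠ j →
      (Rlo i j : ℝ) ≤ ∫ x, ((m80FF i - ∑ l, W i l • m80Fv l) x * conj ((m80FF j - ∑ l, W j l • m80Fv l) x)).re ∧
        ∫ x, ((m80FF i - ∑ l, W i l • m80Fv l) x * conj ((m80FF j - ∑ l, W j l • m80Fv l) x)).re ≤ (Rhi i j : ℝ))
    (lam : ℚ) (hlam : lam < m72βlo) {m : ℕ} (sc : Fin 6 → ℚ) (hsc : ∀ i, 0 < sc i) (P E : Fin 6 → Fin 6 → ℚ)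
    (D : Fin m → ℚ) (L : Fin m → Fin 6 → ℚ) (δ : ℚ)
    (hPE : ∀ i j, ∀ β' ∈ [m72βlo, m72βhi], ∀ a ∈ [m80FTAlo i j - m80FMhi * m80FG i j, m80FTAhi i j - m80FMhi * m80FG i j],
      P i j - E i j ≤ sc i * sc j * nEntry β' lam (m80FG i j) (Rhi i j) a ∧
        sc i * sc j * nEntry β' lam (m80FG i j) (Rlo i j) a ≤ P i j + E i j)
    (hrow : ∀ i, ∑ j, E i j ≤ δ) (hcol : ∀ j, ∑ i, E i j ≤ δ) (hD : ∀ r, 0 ≤ D r)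
    (hP : ∀ i j, P i j = δ * (if i = j then 1 else 0) + ∑ r, D r * L r i * L r j) :
    (lam : ℝ) ≤ weilOddGroundEnergy (4023 / 5000 : ℝ) := by
  have hc : (0 : ℝ) < 4023 / 5000 := by norm_num
  have hc5 : (4023 / 5000 : ℝ) ≤ Real.log 5 / 2 := by have := m80_le_log5; push_cast at this; linarith
  have hβ := m72_beta_mem
  have hlamR : (lam : ℝ) < 17 / 25 - Real.log 2 / 2 := by
    have : ((lam : ℚ) : ℝ) < ((m72βlo : ℚ) : ℝ) := by exact_mod_cast hlam
    linarith [hβ.1]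
  have hcert := fun (g : ℝ → ℂ) (hg : IsWeilTest g) (hsupp : tsupport g ⊆ Icc (-(4023 / 5000 : ℝ)) (4023 / 5000))
      (hodd : ∀ x, g (-x) = -g x) ↦ deflBound_weilCertDeflM80F hg hsupp hodd
  obtain ⟨hN1, ha0⟩ := params_weilCertDeflM80F
  have hβ23 : ((weilCertDeflM80FBeta : ℚ) : ℝ) = 17 / 25 := by show (((17 / 25 : ℚ)) : ℝ) = _; norm_num
  simp only [hN1, ha0, hβ23] at hcert
  have hM : weilMarkovConstant (4023 / 5000 : ℝ) ≤ ((m80FMhi : ℚ) : ℝ) := by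
    have h2 := m80_log2_lt; have h5 := m80_le_log5; push_cast at h2 h5
    have := (dt_weilMarkovConstant_sharp h2 h5).2; unfold m80FMhi; push_cast at this ⊢; exact this
  have hA := m80F_TA_mem
  have hG := m80F_inner
  -- the residuals and the matrix `R'` (certified diagonal bounds, true cross terms)
  set r : Fin 6 → ℝ → ℂ := fun i ↦ m80FF i - ∑ l, W i l • m80Fv l with hr
  set Rm : Fin 6 → Fin 6 → ℝ := fun i j ↦ if i = j then ((s i : ℚ) : ℝ) else ∫ x, (r i x * conj (r j x)).re with hRm
  have hRbox : ∀ i j, (Rlo i j : ℝ) ≤ Rm i j ∧ Rm i j ≤ (Rhi i j : ℝ) := by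
    intro i j
    by_cases hij : i = j
    · subst hij
      obtain ⟨h1, h2⟩ := hRdiag i
      simp only [hRm, if_true, h1, h2]; exact ⟨le_rfl, le_rfl⟩
    · simp only [hRm, if_neg hij, hr]
      exact hR i j hij
  have hN := dt_hN_of_boundsT₃
    (fun i j ↦ weilPoleForm₂ (m80Fv i) (m80Fv j) + weilDirichletEnergy₂ (((4023 / 5000 : ℚ)) : ℝ) (m80Fv i) (m80Fv j))
    m80FTAlo m80FTAhi m80FG hA (fun i j ↦ ∫ x, (m80Fv i x * conj (m80Fv j x)).re) hG
    (M := weilMarkovConstant (4023 / 5000 : ℝ)) m80FMhi hM m80FGD m80FGL m80F_G_ldl.1 m80F_G_ldl.2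
    m72βlo m72βhi hβ Rm Rlo Rhi hRbox lam hlam sc hsc P E D L δ hPE hrow hcol hD hP
  have h1825 : (((4023 / 5000 : ℚ)) : ℝ) = (4023 / 5000 : ℝ) := by norm_num
  simp only [h1825] at hN
  -- cross-Gram criterion ⇒ the bridge's `hPSD`
  have hsR : ∀ i, ∫ x, ‖r i x‖ ^ 2 ≤ ((s i : ℚ) : ℝ) := fun i ↦ by simpa only [hr] using hs i
  have hPSD := dt_psd_of_crossGram
    (fun i j ↦ (17 / 25 - Real.log 2 / 2 - (lam : ℝ)) *
      ((weilPoleForm₂ (m80Fv i) (m80Fv j) + weilDirichletEnergy₂ (4023 / 5000 : ℝ) (m80Fv i) (m80Fv j) -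
          weilMarkovConstant (4023 / 5000 : ℝ) * ∫ x, (m80Fv i x * conj (m80Fv j x)).re) -
        (lam : ℝ) * ∫ x, (m80Fv i x * conj (m80Fv j x)).re))
    r (fun i ↦ ((s i : ℚ) : ℝ)) hsR (fun α ↦ by simpa only [hRm] using hN α)
  exact dt_weilOddGroundEnergy_ge_of_deflCert hc hc5 le_rfl weilCertDeflM80FR 272 m80F_Rodd.1 m80F_Rodd.2 hcert
    m80Fv m80FF (fun i x ↦ (m80F_mask i x).symm) (fun i y ↦ rfl) W hlamR hPSD

end Summit.RiemannHypothesis.RiemannHypothesis.Theorems.EvenWinsBeyondArch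

end
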